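import Summits.KontsevichZagierPeriods.KontsevichZagierPeriods.Theorems.RootDecompRelativeModAbsoluteCylLogSplitP24

/-! # `RootDecompRelativeModAbsoluteCylLogSplitP25` — part 25/25 of the mechanical ≤330-line split of `CylLogSplit.lean`
(split by the decomp-kz census seat for landing; mathematics unchanged; part 25 continues part 24). -/

noncomputable section
open Set MeasureTheory Filter Topology
open scoped BigOperators
open Literature.NumberTheory.Transcendental Literature.ModelTheory.ExponentialFields

namespace Summit.KontsevichZagierPeriods.RootDecompRelativeModAbsolute.Rung30571

namespace RegularisedLogLayer

namespace CylLog
variable {b : ℕ}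

/-- **The ℤ-lattice split (PROVED).** -/
theorem latticeSplit (q R : ℕ) (Z : Fin q → Bool) (f : Fin R → Fin q → ℤ) :
    ∃ (dZ dN : ℕ) (gZ : Fin dZ → Fin q → ℤ) (gN : Fin dN → Fin q → ℤ)
      (nZ : Fin dZ → Fin R → ℤ) (nN : Fin dN → Fin R → ℤ)
      (AZ : Fin R → Fin dZ → ℚ) (AN : Fin R → Fin dN → ℚ) (E : Fin dN → Fin q → ℚ),
      (∀ k i, gZ k i = ∑ r, nZ k r * f r i) ∧ (∀ k i, gN k i = ∑ r, nN k r * f r i) ∧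
      (∀ k i, Z i = false → gZ k i = 0) ∧
      (∀ r i, (f r i : ℚ) = ∑ k, AZ r k * gZ k i + ∑ k, AN r k * gN k i) ∧
      (∀ k k', ∑ i, (if Z i = false then E k i * gN k' i else 0) = if k = k' then (1:ℚ) else 0) := by
  classical
  let fQ : Fin R → (Fin q → ℚ) := fun r i => (f r i : ℚ)
  have hfQ : ∀ r i, fQ r i = (f r i : ℚ) := fun _ _ => rfl
  let L : Submodule ℚ (Fin q → ℚ) := Submodule.span ℚ (Set.range fQ)
  let πN : (Fin q → ℚ) →ₗ[ℚ] (Fin q → ℚ) :=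
    { toFun := fun v i => if Z i = false then v i else 0
      map_add' := by
        intro v w; funext i
        simp only [Pi.add_apply]
        split_ifs <;> simp
      map_smul' := by
        intro a v; funext i
        simp only [Pi.smul_apply, smul_eq_mul, RingHom.id_apply]
        split_ifs <;> simp }
  have hπN : ∀ v i, πN v i = if Z i = false then v i else 0 := fun _ _ => rfl
  let K : Submodule ℚ L := LinearMap.ker (πN.domRestrict L)
  obtain ⟨C, hKC⟩ := Submodule.exists_isCompl K
  haveI : FiniteDimensional ℚ L := FiniteDimensional.span_of_finite ℚ (Set.finite_range fQ)
  haveI : Module.Free ℚ K := Module.Free.of_divisionRing ℚ K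
  haveI : Module.Free ℚ C := Module.Free.of_divisionRing ℚ C
  haveI : Module.Finite ℚ K := inferInstance
  haveI : Module.Finite ℚ C := inferInstance
  let bK := Module.finBasis ℚ K
  let bC := Module.finBasis ℚ C
  -- the vectors
  let uZ : Fin (Module.finrank ℚ K) → (Fin q → ℚ) := fun k => ((bK k : L) : Fin q → ℚ)
  let uN : Fin (Module.finrank ℚ C) → (Fin q → ℚ) := fun k => ((bC k : L) : Fin q → ℚ)
  have huZ : ∀ k, uZ k ∈ L := fun k => (bK k : L).2
  have huN : ∀ k, uN k ∈ L := fun k => (bC k : L).2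
  choose DZ nZ hDZ hZeq using fun k => exists_int_scaling fQ f hfQ (uZ k) (huZ k)
  choose DN nN hDN hNeq using fun k => exists_int_scaling fQ f hfQ (uN k) (huN k)
  -- decomposition of each `f r` along `K ⊕ C`
  have hfr : ∀ r, fQ r ∈ L := fun r => Submodule.subset_span ⟨r, rfl⟩
  have hdec : ∀ r, ∃ (y : K) (z : C), ((y : L) : Fin q → ℚ) + ((z : L) : Fin q → ℚ) = fQ r := by
    intro r
    have hx : (⟨fQ r, hfr r⟩ : L) ∈ K ⊔ C := by rw [hKC.sup_eq_top]; exact Submodule.mem_top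
    obtain ⟨y, hy, z, hz, hyz⟩ := Submodule.mem_sup.mp hx
    refine ⟨⟨y, hy⟩, ⟨z, hz⟩, ?_⟩
    have := congrArg (fun w : L => (w : Fin q → ℚ)) hyz
    simpa using this
  choose y z hyz using hdec
  -- left inverse of `πN` on `C`
  let ψ : C →ₗ[ℚ] (Fin q → ℚ) := (πN.domRestrict L).comp C.subtype
  have hψ : ∀ c : C, ψ c = πN ((c : L) : Fin q → ℚ) := fun _ => rfl
  have hker : LinearMap.ker ψ = ⊥ := by
    rw [LinearMap.ker_eq_bot']
    intro c hc
    have h1 : (c : L) ∈ K := by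
      rw [LinearMap.mem_ker]
      exact hc
    have h2 : (c : L) ∈ K ⊓ C := ⟨h1, c.2⟩
    rw [hKC.inf_eq_bot, Submodule.mem_bot] at h2
    exact Subtype.ext h2
  obtain ⟨G, hG⟩ := LinearMap.exists_leftInverse_of_injective (V := ↥C) (V' := Fin q → ℚ) ψ hker
  have hGψ : ∀ c : C, G (ψ c) = c := fun c => by
    have := congrArg (fun T => T c) hG
    simpa using this
  refine ⟨Module.finrank ℚ K, Module.finrank ℚ C,
    fun k i => ∑ r, nZ k r * f r i, fun k i => ∑ r, nN k r * f r i, nZ, nN,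
    fun r k => (bK.repr (y r)) k / (DZ k : ℚ), fun r k => (bC.repr (z r)) k / (DN k : ℚ),
    fun k i => (bC.repr (G (Pi.single i 1))) k / (DN k : ℚ),
    fun _ _ => rfl, fun _ _ => rfl, ?_, ?_, ?_⟩
  · -- (ii) `gZ` is supported on `Z`
    intro k i hi
    have hk : πN (uZ k) = 0 := by
      have := (bK k).2
      rw [LinearMap.mem_ker] at this
      exact this
    have hki : uZ k i = 0 := by
      have := congrFun hk i
      rw [hπN] at this
      simpa [hi] using this
    have h := hZeq k i
    rw [hki, mul_zero] at h
    exact_mod_cast h.symm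
  · -- (iii) `f r` re-expressed
    intro r i
    have hyr : ((y r : L) : Fin q → ℚ) i = ∑ k, (bK.repr (y r)) k * uZ k i := by
      conv_lhs => rw [← bK.sum_repr (y r)]
      simp only [Submodule.coe_sum, Submodule.coe_smul, Finset.sum_apply, Pi.smul_apply, smul_eq_mul, uZ]
    have hzr : ((z r : L) : Fin q → ℚ) i = ∑ k, (bC.repr (z r)) k * uN k i := by
      conv_lhs => rw [← bC.sum_repr (z r)]
      simp only [Submodule.coe_sum, Submodule.coe_smul, Finset.sum_apply, Pi.smul_apply, smul_eq_mul, uN]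
    have hsum := congrFun (hyz r) i
    simp only [Pi.add_apply] at hsum
    rw [← hfQ, ← hsum, hyr, hzr]
    congr 1
    · refine Finset.sum_congr rfl fun k _ => ?_
      have hD : (DZ k : ℚ) ≠ 0 := by exact_mod_cast hDZ k
      push_cast
      rw [← hZeq k i]
      field_simp
    · refine Finset.sum_congr rfl fun k _ => ?_
      have hD : (DN k : ℚ) ≠ 0 := by exact_mod_cast hDN k
      push_cast
      rw [← hNeq k i]
      field_simp
  · -- (iv) the left inverse reads the `C`-coefficients off the `N`-coordinates
    intro k k'
    have hlin : ∀ w : Fin q → ℚ, ∑ i, (bC.repr (G (Pi.single i 1))) k * w i = (bC.repr (G w)) k := by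
      intro w
      have hw : w = ∑ i, w i • (Pi.single i (1:ℚ) : Fin q → ℚ) := by
        ext j
        simp [Finset.sum_apply, Pi.single_apply]
      conv_rhs => rw [hw]
      simp only [map_sum, map_smul, Finsupp.coe_finsetSum, Finsupp.coe_smul, Finset.sum_apply,
        Pi.smul_apply, smul_eq_mul]
      exact Finset.sum_congr rfl fun i _ => mul_comm _ _
    have hstep : ∀ i, (if Z i = false then (bC.repr (G (Pi.single i 1))) k / (DN k : ℚ) *
        ((∑ r, nN k' r * f r i : ℤ) : ℚ) else 0) =
        (DN k' : ℚ) / (DN k : ℚ) * ((bC.repr (G (Pi.single i 1))) k * πN (uN k') i) := by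
      intro i
      rw [hπN]
      split_ifs with hi
      · push_cast
        rw [← hNeq k' i]
        ring
      · ring
    rw [Finset.sum_congr rfl fun i _ => hstep i, ← Finset.mul_sum, hlin]
    have hGk : G (πN (uN k')) = bC k' := by
      have := hGψ (bC k')
      rwa [hψ] at this
    rw [hGk, bC.repr_self]
    by_cases hkk : k = k'
    · subst hkk
      simp [Finsupp.single_eq_same, div_self (show (DN k : ℚ) ≠ 0 by exact_mod_cast hDN k)]
    · have : k' ≠ k := fun h => hkk h.symm
      simp [hkk]

/-! ## §4 The analytic leaf: power bounds for one-variable semialgebraic functions — PROVED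
(companion file `OneVarPowerBounds.lean`, same directory: the `Prop` below is re-declared there VERBATIM and
`CylLogLeaf.oneVarPowerBounds_holds : OneVarPowerBounds` is proved from the tree's growth dichotomy
`exists_mul_pow_le_abs_of_isSemialgebraic_graph` / `exists_abs_pow_le_mul_of_tendsto`
(`Literature.ModelTheory.ExponentialFields.SemialgebraicC1TriangulationProofs`; HaPham2016 Lemma 1.7,
OhmotoShiota2017 Lemma 3.5); kept in a separate file only because that import forces a cold re-elaboration of
this file beyond the farm transport timeout). -/

/-- **`OneVarPowerBounds`** — at a finite endpoint `a` of an interval, a `ℚ`-semialgebraic function of one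
variable is bounded by a negative power of `t − a`, and one that tends to `0` is bounded by a positive
(rational) power of `t − a`.  (Puiseux expansion / the Cauchy bound on the roots of the polynomial relation
`q(φ(t), t) = 0` supplied by the tree's `stub_oneVarSemialgebraic`.)  In the glue it yields the exponent `m`
with `q_r κᵢ^{m+1} ∈ L¹` near a degenerate end.  [tag: KNOWN (BCR 1998 §2.6, Łojasiewicz inequality /
Puiseux; van den Dries 1998 Ch. 7) · ATTACKABLE-NOW, Lean-M; strictly WEAKER than the summit (no periods)] -/
def OneVarPowerBounds : Prop :=
  ∀ (φ : ℝ → ℝ) (a c : ℝ), a < c →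
    IsSemialgebraicFunOn ℚ {x : Fin 1 → ℝ | x 0 ∈ Set.Ioo a c} (fun x => φ (x 0)) →
    (∃ (K : ℕ) (C δ : ℝ), 0 < δ ∧ ∀ t ∈ Set.Ioo a (a + δ), |φ t| ≤ C * (t - a) ^ (-(K : ℤ))) ∧
    (Tendsto φ (𝓝[>] a) (𝓝 0) →
      ∃ (N : ℕ) (C δ : ℝ), 0 < N ∧ 0 < δ ∧ ∀ t ∈ Set.Ioo a (a + δ), |φ t| ≤ C * (t - a) ^ ((N : ℝ)⁻¹))

/-- **`OneVarLeadingPower`** — the master form of the one-variable toolkit (Newton–Puiseux for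
semialgebraic germs): a `ℚ`-semialgebraic function of one variable is, to the right of a finite endpoint `a`,
either eventually `0` or asymptotic to `C (t−a)^γ` with `C ≠ 0`, `γ ∈ ℚ`.  It implies `OneVarPowerBounds`
and the log-tameness used in the glue (`φ ∈ L¹` near `a` ⇒ `γ > −1` ⇒ `φ · |log(t−a)|^k ∈ L¹`).
[tag: KNOWN (Basu–Pollack–Roy 2006 §2.6 Newton–Puiseux, Thm 2.91, and §3.3, corpus pp. 131–139;
BCR 1998 §8.1) · ATTACKABLE-NOW, Lean-M (the polynomial relation `q(φ(t),t) = 0` is the tree's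
`stub_oneVarSemialgebraic`); strictly WEAKER than the summit (no periods)] -/
def OneVarLeadingPower : Prop :=
  ∀ (φ : ℝ → ℝ) (a c : ℝ), a < c →
    IsSemialgebraicFunOn ℚ {x : Fin 1 → ℝ | x 0 ∈ Set.Ioo a c} (fun x => φ (x 0)) →
    (∀ᶠ t in 𝓝[>] a, φ t = 0) ∨
      ∃ (C : ℝ) (γ : ℚ), C ≠ 0 ∧
        Tendsto (fun t => φ t / (t - a) ^ ((γ : ℚ) : ℝ)) (𝓝[>] a) (𝓝 C)

end CylLog

end RegularisedLogLayer

end Summit.KontsevichZagierPeriods.RootDecompRelativeModAbsolute.Rung30571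

end

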